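import Literature.NumberTheory.EllipticCurves.Kato2004.UniversalNormsTools
import Literature.NumberTheory.EllipticCurves.Kato2004.UniversalNormsInertiaFinite
import Literature.NumberTheory.EllipticCurves.Kato2004.UniversalNormsLayers
import Literature.NumberTheory.EllipticCurves.Kato2004.IwasawaH1NormCompatibleIntegral
import Literature.NumberTheory.EllipticCurves.ZpExtensionUnramifiedProofs
import Literature.NumberTheory.EllipticCurves.IsogenyFrobeniusTraceProofs
import Literature.NumberTheory.GaloisRepresentations.ContinuousCorestrictionResNormal
import Literature.NumberTheory.GaloisRepresentations.ConjugationDescent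
import HarnessLib

/-!
# Kato 2004 (Astérisque 295) Lemma 8.5 (2) on the pin is a THEOREM: norm-compatible families of
# classes of `T_pW` along the cyclotomic `ℤ_p`-tower are integral (no hypothesis on `p • z_n`)

Topic `NumberTheory/EllipticCurves`, sub-directory `Kato2004` (namespace = path).  Cell `bsd-smallim`
(rung K6 of `BirchSwinnertonDyer`), seat `bsd-smallim-k6-lur-a` (gen 3).  THEOREMS ONLY (no definition,
no named fact, no `sorry`).  This file DISCHARGES the named fact
`Kato2004.mem_integralH1_of_forall_layerCores_eq` (`IwasawaH1NormCompatibleIntegral.lean`, k6-g4 gen 2):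

* `Kato2004.mem_integralH1_of_forall_layerCores_eq_holds` — **Kato's Lemma 8.5 (2) read on the layers
  of the cyclotomic `ℤ_p`-extension for `T = T_pW`**: for every elliptic curve `W/ℚ`, prime `p`,
  cyclotomic `κ` and every family `z_n ∈ H¹(ℚ_n, T_pW)` with `Cor z_{n+1} = z_n`, every `z_n` lies in
  `H¹(ℤ_n[1/p], T_pW)` (= `Kato2004.integralH1`: unramified at every prime not above `p`).  Printed:
  "The image of `lim←_n H¹(K(ζ_{p^n}), T) → H¹(K, T)` is contained in the image of
  `H¹(O_K[1/p], T) → H¹(K, T)`" [Kato, Lemma 8.5 (2), p. 183; = Rubin, *Euler Systems*, B.3.3;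
  Perrin-Riou, Astérisque 229, 2.2.4].
* `Kato2004.mem_pSmul_of_red_eq_zero_holds` — consequently Kato's §13.8 "`𝐇¹(T)/p𝐇¹(T) ⊂ 𝐇¹(T/p)`" on
  the pin (the named fact F2 of the K6 crux `MuTransferX9`) holds, via k6-g4's
  `mem_pSmul_of_red_eq_zero_of_lemma_8_5` — the Literature-side twin of the `Summits` theorem
  `UniversalNorms.mem_pSmul_of_red_eq_zero_holds` (lur-a gen 2, p480014, which went through the WEAK form
  of Lemma 8.5 (2) with the extra hypothesis "`p • z_n` integral").

## Proof (no Frobenius weights)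

Fix `v ≠ p` and `𝔓 ∣ v`; every inertia group over `v` lies in every layer `Γ_m`
(`ZpExtension.inertia_le_kerSubgroup_holds`).  Above a layer `n₀` every prime over `v` is inert
(`UniversalNorms.exists_generator`): for `n' ≥ n₀` and every `k` some `φ ∈ D_𝔓' ∩ Γ_{n'}` generates
`Γ_{n'}/Γ_{n'+k}`.  **Inert step** (`exists_resLe_coresLe_eq_pow_smul_of_generator`): for
`M = H¹(Γ_{n'} ∩ I_𝔓', T_pW)` and `m ≥ 0` let `S ⊆ M` be a finite set of residues modulo `p^m M`
(`exists_finset_forall_sub_eq_pow_smul`: `M/pM ↪ H¹(Γ_{n'} ∩ I_𝔓', W[p])`, finite by the LOCAL theorem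
`#H¹(I_{ℚ_v}, W[p]) ≤ p²` transported along `I_{𝔓'} = ρ res(I_{ℚ_v}) ρ⁻¹`) and `#S · p^m ≤ p^k`; then
`res_{Γ_{n'} ∩ I_𝔓'} (cor_{Γ_{n'+k} → Γ_{n'}} ξ) ∈ p^m M` for every `ξ`: by the normal case of the double
coset formula with representatives `φ^i` (`resLe_coresLe_eq_sum_conjMap`) it is `∑_{i<p^k} res(φ^i ξ)`, a
`p^k`-periodic sequence which is shift-deterministic MODULO `p^m M` (divisibility by `p^m` is transported by
`res ∘ conj_φ`, `exists_resLe_conjMap_eq_smul`), hence sums to `0` in the finite module `M/p^m M`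
(`sum_range_pow_eq_zero_of_periodic_of_pow_smul`).  Since `z_{n'} = cor z_{n'+k}` for every `k`,
`res z_{n'} ∈ ⋂_m p^m M = 0` (`eq_zero_of_forall_exists_pow_smul_eq`, compactness of `T_pW`).  Finally
`res_{Γ_n ∩ I_𝔓} z_n = res (cor z_{n'}) = 0` by the class-level transport
`resLe_coresLe_eq_zero_of_forall_primesAbove`.

References: K. Kato, Astérisque 295 (2004), §8.2, Lemma 8.5 (pp. 180–184), §12.2 (p. 220), §13.8
(pp. 228–229) [Kato2004Asterisque]; K. Rubin, *Euler Systems* (2000), App. B Prop. B.3.3 [Rubin2000];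
J. Neukirch, A. Schmidt, K. Wingberg, *Cohomology of Number Fields* (2008), I §5 (1.5.6)–(1.5.7)
[NeukirchSchmidtWingberg2008]; L. Washington, *Introduction to Cyclotomic Fields* (1997), Prop. 13.2
[Washington1997].
-/

noncomputable section

open scoped NumberField Pointwise
open CategoryTheory Field IsDedekindDomain
open Literature.NumberTheory.GaloisRepresentations
open Literature.NumberTheory.EllipticCurves
open Literature.NumberTheory.EllipticCurves.ZpExtension
open Literature.NumberTheory.EllipticCurves.Kato2004
open Literature.NumberTheory.EllipticCurves.Kato2004.EulerSystemValues
open Rat.HeightOneSpectrum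

namespace Literature.NumberTheory.EllipticCurves.Kato2004

namespace UniversalNorms

/-! ## §1 The inert step modulo `p^m` -/

section Inert

variable (W : WeierstrassCurve ℚ) [W.IsElliptic] (p : ℕ) [Fact p.Prime]
  [ContinuousSMul ℤ_[p] (W.tateModule p)]

/-- Two successive restrictions are the restriction along the composite inclusion (private copy of the
tree's `resLe_resLe`). [cite: SerreGaloisCohomology1997, I §2.4] -/
private theorem resLe_resLe' {H H' H'' : Subgroup (absoluteGaloisGroup ℚ)} (h : H ≤ H') (h' : H' ≤ H'')
    (c : H1 (tateRep W p) H'') :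
    resLe (tateRep W p).toTopRep h 1 (resLe (tateRep W p).toTopRep h' 1 c) =
      resLe (tateRep W p).toTopRep (h.trans h') 1 c := by
  obtain ⟨ψ, rfl⟩ := oneCocycleClass_surjective _ c
  rw [resLe_oneCocycleClass, resLe_oneCocycleClass, resLe_oneCocycleClass]
  exact congrArg _ (Subtype.ext (ContinuousMap.ext fun _ => rfl))

/-- **Inert step modulo `p^m`.**  `V ⊴ Γ_ℚ` open in `U ≥ V` with `U/V` of order `p ^ k` generated by the
class of an element `φ ∈ U` of the decomposition group of `𝔓 ∣ v` (`φ • 𝔓 = 𝔓`), `I_𝔓 ≤ V`, and a finite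
set `S` of residues of `M = H¹(U ∩ I_𝔓, T_pW)` modulo `p^m M` with `#S · p^m ≤ p^k`.  Then for every
`ξ ∈ H¹(V, T_pW)`, `res_{U ∩ I_𝔓} (cor_{V→U} ξ) ∈ p^m M`: by the normal case of the double coset formula
with representatives `φ^i` (`resLe_coresLe_eq_sum_conjMap`), `res_{U ∩ I_𝔓} (cor ξ) = Σ_{i<p^k} res (φ^i · ξ)`,
a `p^k`-periodic sequence which is shift-deterministic modulo `p^m M` (`exists_resLe_conjMap_eq_smul`), so
the periodicity lemma applies in the finite module `M/p^m M`.
[cite: NeukirchSchmidtWingberg2008, I §5 (1.5.6)–(1.5.7)] [cite: Kato2004Asterisque, Lemma 8.5 (2) (pp. 183–184)] -/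
theorem exists_resLe_coresLe_eq_pow_smul_of_generator
    {V U : Subgroup (absoluteGaloisGroup ℚ)} [V.Normal] (h : V ≤ U)
    (hV : IsOpen (V : Set (absoluteGaloisGroup ℚ))) [Fintype (U ⧸ V.subgroupOf U)]
    {k : ℕ} (hPk : Fintype.card (U ⧸ V.subgroupOf U) = p ^ k)
    {𝔓 : Ideal (absIntegers (𝓞 ℚ) ℚ)} (hIV : 𝔓.inertia (absoluteGaloisGroup ℚ) ≤ V)
    {φ : absoluteGaloisGroup ℚ} (hφU : φ ∈ U) (hφ𝔓 : φ • 𝔓 = 𝔓)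
    (hgen : ∀ u ∈ U, ∃ i : ℕ, (φ ^ i)⁻¹ * u ∈ V) {m : ℕ}
    (S : Finset (H1 (tateRep W p) (U ⊓ 𝔓.inertia (absoluteGaloisGroup ℚ))))
    (hS : ∀ x, ∃ s ∈ S, ∃ y : H1 (tateRep W p) (U ⊓ 𝔓.inertia (absoluteGaloisGroup ℚ)),
      x - s = ((p : ℤ_[p]) ^ m) • y)
    (hcard : S.card * p ^ m ≤ p ^ k) (ξ : H1 (tateRep W p) V) :
    ∃ y : H1 (tateRep W p) (U ⊓ 𝔓.inertia (absoluteGaloisGroup ℚ)),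
      resLe (tateRep W p).toTopRep (inf_le_left : U ⊓ 𝔓.inertia (absoluteGaloisGroup ℚ) ≤ U) 1
        (coresLe (tateRep W p).toTopRep h hV ξ) = ((p : ℤ_[p]) ^ m) • y := by
  classical
  set X := (tateRep W p).toTopRep with hX
  set P := Fintype.card (U ⧸ V.subgroupOf U) with hP
  have hp : p.Prime := Fact.out
  -- `φ ^ P ∈ V`
  have hφP : φ ^ P ∈ V := by
    have h1 : (((⟨φ, hφU⟩ : U) : U ⧸ V.subgroupOf U)) ^ P = 1 := pow_card_eq_one
    rw [← QuotientGroup.mk_pow, QuotientGroup.eq_one_iff, Subgroup.mem_subgroupOf,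
      SubgroupClass.coe_pow] at h1
    exact h1
  -- the bijection `Fin P ≃ U/V`, `i ↦ [φ^i]`
  let f : Fin P → U ⧸ V.subgroupOf U := fun i => (((⟨φ, hφU⟩ : U) ^ (i : ℕ) : U) : U ⧸ V.subgroupOf U)
  have hfsurj : Function.Surjective f := by
    intro x
    induction x using QuotientGroup.induction_on with
    | H u =>
      obtain ⟨i, hi⟩ := hgen u u.2
      have hPpos : 0 < P := Fintype.card_pos
      refine ⟨⟨i % P, Nat.mod_lt _ hPpos⟩, ?_⟩
      change (((⟨φ, hφU⟩ : U) ^ (i % P) : U) : U ⧸ V.subgroupOf U) = (u : U ⧸ V.subgroupOf U)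
      rw [QuotientGroup.eq, Subgroup.mem_subgroupOf]
      push_cast
      have hdecomp : (φ ^ (i % P))⁻¹ * (u : absoluteGaloisGroup ℚ) =
          (φ ^ P) ^ (i / P) * ((φ ^ i)⁻¹ * (u : absoluteGaloisGroup ℚ)) := by
        have hpow : φ ^ i = φ ^ (i % P) * (φ ^ P) ^ (i / P) := by
          rw [← pow_mul, ← pow_add, Nat.mod_add_div]
        rw [hpow, mul_inv_rev, ← mul_assoc, ← mul_assoc, mul_inv_cancel, one_mul]
      rw [hdecomp]
      exact V.mul_mem (V.pow_mem hφP _) hi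
  have hfbij : Function.Bijective f :=
    (Fintype.bijective_iff_surjective_and_card f).mpr ⟨hfsurj, by simp [hP]⟩
  let e : Fin P ≃ U ⧸ V.subgroupOf U := Equiv.ofBijective f hfbij
  let s : U ⧸ V.subgroupOf U → U := fun x => (⟨φ, hφU⟩ : U) ^ ((e.symm x : Fin P) : ℕ)
  have hs : ∀ x, (s x : U ⧸ V.subgroupOf U) = x := fun x => by
    change f (e.symm x) = x
    exact e.apply_symm_apply x
  -- `res_V (cor ξ) = Σ_{i<P} φ^i · ξ`
  have hsum : resLe X h 1 (coresLe X h hV ξ) = ∑ i ∈ Finset.range P, conjMap X V (φ ^ i) 1 ξ := by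
    rw [resLe_coresLe_eq_sum_conjMap X h hV hs ξ]
    have hsx : ∀ x, ((s x : U) : absoluteGaloisGroup ℚ) = φ ^ ((e.symm x : Fin P) : ℕ) := fun x => by
      simp only [s, SubgroupClass.coe_pow]
    simp_rw [hsx]
    rw [e.symm.sum_comp (fun i : Fin P => conjMap X V (φ ^ (i : ℕ)) 1 ξ),
      Fin.sum_univ_eq_sum_range (fun i => conjMap X V (φ ^ i) 1 ξ) P]
  -- the sequence `a i = res_{U ∩ I_𝔓} (φ^i · ξ)` and the submodule `N = p^m M`
  have hIU : U ⊓ 𝔓.inertia (absoluteGaloisGroup ℚ) ≤ V := fun g hg => hIV hg.2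
  have hconjI : ∀ g ∈ U ⊓ 𝔓.inertia (absoluteGaloisGroup ℚ),
      φ⁻¹ * g * φ ∈ U ⊓ 𝔓.inertia (absoluteGaloisGroup ℚ) := by
    intro g hg
    refine ⟨U.mul_mem (U.mul_mem (U.inv_mem hφU) hg.1) hφU, ?_⟩
    refine (Ideal.conj_mem_inertia_smul_iff 𝔓 φ (φ⁻¹ * g * φ)).mp ?_
    rw [hφ𝔓, show φ * (φ⁻¹ * g * φ) * φ⁻¹ = g by group]
    exact hg.2
  let a : ℕ → H1 (tateRep W p) (U ⊓ 𝔓.inertia (absoluteGaloisGroup ℚ)) := fun i =>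
    resLe X hIU 1 (conjMap X V (φ ^ i) 1 ξ)
  let N : Submodule ℤ_[p] (H1 (tateRep W p) (U ⊓ 𝔓.inertia (absoluteGaloisGroup ℚ))) :=
    LinearMap.range (((p : ℤ_[p]) ^ m) • LinearMap.id)
  have hN : ∀ x : H1 (tateRep W p) (U ⊓ 𝔓.inertia (absoluteGaloisGroup ℚ)),
      x ∈ N ↔ ∃ y, x = ((p : ℤ_[p]) ^ m) • y := by
    intro x
    simp only [N, LinearMap.mem_range, LinearMap.smul_apply, LinearMap.id_apply]
    exact ⟨fun ⟨y, hy⟩ => ⟨y, hy.symm⟩, fun ⟨y, hy⟩ => ⟨y, hy.symm⟩⟩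
  have htrans : resLe X (inf_le_left : U ⊓ 𝔓.inertia (absoluteGaloisGroup ℚ) ≤ U) 1
      (coresLe X h hV ξ) = resLe X hIU 1 (resLe X h 1 (coresLe X h hV ξ)) :=
    (resLe_resLe' W p hIU h _).symm
  -- reduce to `Σ a i ∈ N`
  suffices hmem : ∑ i ∈ Finset.range P, a i ∈ N by
    obtain ⟨y, hy⟩ := (hN _).mp hmem
    refine ⟨y, ?_⟩
    rw [htrans, hsum, map_sum]
    exact hy
  -- work in `M / N`
  let π := N.mkQ
  have hπa : ∀ i j, π (a i) = π (a j) → π (a (i + 1)) = π (a (j + 1)) := by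
    intro i j hij
    rw [Submodule.mkQ_apply, Submodule.mkQ_apply, Submodule.Quotient.eq] at hij ⊢
    obtain ⟨c, hc⟩ := (hN _).mp hij
    have hy : resLe X hIU 1 (conjMap X V (φ ^ i) 1 ξ - conjMap X V (φ ^ j) 1 ξ) =
        ((p : ℤ_[p]) ^ m) • c := by
      rw [map_sub]; exact hc
    obtain ⟨c', hc'⟩ := exists_resLe_conjMap_eq_smul X V φ hIU hIU hconjI ((p : ℤ_[p]) ^ m) hy
    refine (hN _).mpr ⟨c', ?_⟩
    rw [← hc']
    change resLe X hIU 1 (conjMap X V (φ ^ (i + 1)) 1 ξ) - resLe X hIU 1 (conjMap X V (φ ^ (j + 1)) 1 ξ) = _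
    rw [pow_succ', pow_succ', ← conjMap_conjMap X V (φ ^ i) φ 1 ξ, ← conjMap_conjMap X V (φ ^ j) φ 1 ξ,
      ← map_sub, ← map_sub]
  have hper : ∀ i, a (i + p ^ k) = a i := by
    intro i
    change resLe X hIU 1 (conjMap X V (φ ^ (i + p ^ k)) 1 ξ) = resLe X hIU 1 (conjMap X V (φ ^ i) 1 ξ)
    rw [pow_add, ← conjMap_conjMap X V (φ ^ p ^ k) (φ ^ i) 1 ξ, ← hPk,
      conjMap_eq_self_of_mem_one X V hφP ξ]
  -- the periodicity lemma in `M / N`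
  have haS : ∀ i, π (a i) ∈ S.image π := by
    intro i
    obtain ⟨s, hs, y, hy⟩ := hS (a i)
    rw [Finset.mem_image]
    refine ⟨s, hs, ?_⟩
    rw [Submodule.mkQ_apply, Submodule.mkQ_apply, Submodule.Quotient.eq]
    exact (hN _).mpr ⟨-y, by rw [smul_neg, ← hy]; abel⟩
  have hcard' : (S.image π).card * p ^ m ≤ p ^ k :=
    le_trans (Nat.mul_le_mul_right _ Finset.card_image_le) hcard
  have htor : ∀ i, p ^ m • π (a i) = 0 := by
    intro i
    rw [← Nat.cast_smul_eq_nsmul ℤ_[p], Nat.cast_pow, ← map_smul, Submodule.mkQ_apply,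
      Submodule.Quotient.mk_eq_zero]
    exact (hN _).mpr ⟨a i, rfl⟩
  have hzero := sum_range_pow_eq_zero_of_periodic_of_pow_smul hp (fun i => π (a i)) haS hcard'
    (fun i => by simp only [hper]) hπa htor
  rw [hPk, ← Submodule.Quotient.mk_eq_zero N, ← Submodule.mkQ_apply, map_sum]
  exact hzero

end Inert

/-! ## §2 Kato's Lemma 8.5 (2) on the pin -/

section Assembly

variable (W : WeierstrassCurve ℚ) [W.IsElliptic] (p : ℕ) [Fact p.Prime]
  [ContinuousSMul ℤ_[p] (W.tateModule p)]

/-- **Kato 2004, Lemma 8.5 (2), in the currency of the pin `Kato2004.IwasawaH1Data` — strong form.**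
Let `W/ℚ` be an elliptic curve, `p` a prime, `κ` the cyclotomic `ℤ_p`-extension with layers
`ℚ_n = ℚ̄^{Γ_n}`, and `z = (z_n)_n`, `z_n ∈ H¹(ℚ_n, T_pW)`, a NORM-COMPATIBLE family (`Cor z_{n+1} = z_n`).
Then every `z_n` is integral (unramified at every `v ≠ p`: `Kato2004.integralH1`).  Printed: "The image
of `lim←_n H¹(K(ζ_{p^n}), T) → H¹(K, T)` is contained in the image of `H¹(O_K[1/p], T) → H¹(K, T)`"
[Kato, Lemma 8.5 (2), p. 183; = Rubin, *Euler Systems*, B.3.3].  PROOF: module docstring (inert layers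
`n' ≥ n₀`, inert step modulo every `p^m`, `⋂_m p^m H¹(Γ_{n'} ∩ I_𝔓', T_pW) = 0`, class-level transport
along `cor_{Γ_{n'} → Γ_n}`). [cite: Kato2004Asterisque, Lemma 8.5 (2) (p. 183)] [cite: Rubin2000, App. B Prop. B.3.3] -/
theorem mem_integralH1_of_layerCores_eq (κ : ZpExtension ℚ p) (hκ : κ.IsCyclotomic)
    (z : ∀ n : ℕ, H1 (tateRep W p) (κ.layerSubgroup n))
    (hz : ∀ n, layerCores (tateRep W p) κ n (z (n + 1)) = z n) (n : ℕ) :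
    z n ∈ integralH1 (tateRep W p) p (κ.layerSubgroup n) := by
  classical
  have hp : p.Prime := Fact.out
  rw [mem_integralH1_iff]
  intro v hv 𝔓 h𝔓
  have hvp : (p : 𝓞 ℚ) ∉ v.asIdeal := WeierstrassCurve.natCast_not_mem_asIdeal_of_primesEquiv_ne hp hv
  -- the inertia groups above `v` lie in every layer
  have hIle : ∀ 𝔓' ∈ v.primesAbove, ∀ m : ℕ,
      𝔓'.inertia (absoluteGaloisGroup ℚ) ≤ κ.layerSubgroup m := fun 𝔓' h𝔓' m =>
    (ZpExtension.inertia_le_kerSubgroup_holds ℚ p κ hvp h𝔓').trans (κ.kerSubgroup_le_layerSubgroup m)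
  -- generator data above the layer `n₀`
  obtain ⟨n₀, hn₀⟩ := exists_generator κ hκ hvp h𝔓
  obtain ⟨d, hd⟩ : ∃ d : ℕ, n₀ ≤ n + d + 1 := ⟨n₀, by omega⟩
  -- Step A: `z_{n'}` is unramified at every prime over `v`, `n' = n + d + 1`
  have hA : ∀ 𝔓' ∈ v.primesAbove, resLe (tateRep W p).toTopRep
      (inf_le_left : κ.layerSubgroup (n + d + 1) ⊓ 𝔓'.inertia (absoluteGaloisGroup ℚ) ≤ _) 1
      (z (n + d + 1)) = 0 := by
    intro 𝔓' h𝔓'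
    refine eq_zero_of_forall_exists_pow_smul_eq W p _ _ fun m => ?_
    obtain ⟨S, hS⟩ := exists_finset_forall_sub_eq_pow_smul W p hvp h𝔓' (hIle 𝔓' h𝔓' (n + d + 1)) m
    set K := S.card * p ^ m with hK
    have hcard : S.card * p ^ m ≤ p ^ (K + 1) :=
      ((Nat.lt_pow_self hp.one_lt).le).trans (Nat.pow_le_pow_right hp.pos (Nat.le_succ K))
    obtain ⟨φ, hφ𝔓, hφU, hgen⟩ := hn₀ 𝔓' h𝔓' (n + d + 1) hd (K + 1)
    haveI := finiteIndex_layerSubgroup p κ (n + d + 1 + K + 1)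
    letI : Fintype (κ.layerSubgroup (n + d + 1) ⧸
        (κ.layerSubgroup (n + d + 1 + K + 1)).subgroupOf (κ.layerSubgroup (n + d + 1))) :=
      Fintype.ofFinite _
    have hle : κ.layerSubgroup (n + d + 1 + K + 1) ≤ κ.layerSubgroup (n + d + 1) :=
      κ.layerSubgroup_antitone (Nat.le_add_right (n + d + 1) (K + 1))
    have hPk : Fintype.card (κ.layerSubgroup (n + d + 1) ⧸
        (κ.layerSubgroup (n + d + 1 + K + 1)).subgroupOf (κ.layerSubgroup (n + d + 1))) =
        p ^ (K + 1) := by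
      rw [Fintype.card_eq_nat_card]
      have h1 := Subgroup.relIndex_mul_index hle
      rw [index_layerSubgroup, index_layerSubgroup] at h1
      have h2 : (κ.layerSubgroup (n + d + 1 + K + 1)).relIndex (κ.layerSubgroup (n + d + 1)) *
          p ^ (n + d + 1) = p ^ (K + 1) * p ^ (n + d + 1) := by
        rw [h1, ← pow_add]
        congr 1
        omega
      exact Nat.eq_of_mul_eq_mul_right (pow_pos hp.pos _) h2
    have hgen' : ∀ u ∈ κ.layerSubgroup (n + d + 1), ∃ i : ℕ,
        (φ ^ i)⁻¹ * u ∈ κ.layerSubgroup (n + d + 1 + K + 1) := by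
      intro u hu
      obtain ⟨i, hi⟩ := hgen u hu
      exact ⟨i, by rw [add_assoc (n + d + 1)]; exact hi⟩
    obtain ⟨y, hy⟩ := exists_resLe_coresLe_eq_pow_smul_of_generator W p hle (κ.isOpen_layerSubgroup _)
      hPk (hIle 𝔓' h𝔓' _) hφU hφ𝔓 hgen' S hS hcard (z (n + d + 1 + K + 1))
    refine ⟨y, ?_⟩
    rw [eq_coresLe_add_succ W p κ z hz (n + d + 1) K, hy]
  -- Step B: transport along `cor_{Γ_{n'} → Γ_n}` at class level
  haveI := finiteIndex_layerSubgroup p κ (n + d + 1)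
  letI : Fintype (κ.layerSubgroup n ⧸ (κ.layerSubgroup (n + d + 1)).subgroupOf (κ.layerSubgroup n)) :=
    Fintype.ofFinite _
  rw [eq_coresLe_add_succ W p κ z hz n d]
  exact resLe_coresLe_eq_zero_of_forall_primesAbove (tateRep W p)
    (κ.layerSubgroup_antitone (Nat.le_add_right n (d + 1))) (κ.isOpen_layerSubgroup (n + d + 1))
    (fun 𝔓' h𝔓' g _ hgI => hIle 𝔓' h𝔓' _ hgI) hA h𝔓

end Assembly

end UniversalNorms

/-! ## §3 The named facts are theorems -/

/-- **Kato 2004, Lemma 8.5 (2) on the pin is a theorem**: the named fact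
`Kato2004.mem_integralH1_of_forall_layerCores_eq` (`IwasawaH1NormCompatibleIntegral.lean`) holds —
for every elliptic curve `W/ℚ`, prime `p`, cyclotomic `ℤ_p`-extension `κ` and every norm-compatible
family `z_n ∈ H¹(ℚ_n, T_pW)` along its layers, every `z_n` lies in `H¹(ℤ_n[1/p], T_pW)`.
[cite: Kato2004Asterisque, Lemma 8.5 (2) (p. 183)] [cite: Rubin2000, App. B Prop. B.3.3] -/
theorem mem_integralH1_of_forall_layerCores_eq_holds : mem_integralH1_of_forall_layerCores_eq := by
  intro W _ p _ _ κ hκ z hz n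
  exact UniversalNorms.mem_integralH1_of_layerCores_eq W p κ hκ z hz n

/-- **Kato 2004 §13.8 "`𝐇¹(T)/p𝐇¹(T) ⊂ 𝐇¹(T/p)`" on the pin is a theorem** (Literature-side discharge of
the named fact F2 `Kato2004.mem_pSmul_of_red_eq_zero` of the K6 crux `MuTransferX9`): for every datum
`I : IwasawaH1Data W p κ γ` (`κ` cyclotomic) and `x ∈ 𝐇¹` with `red x = 0`, `x ∈ p·𝐇¹` — from Lemma 8.5 (2)
(`mem_integralH1_of_forall_layerCores_eq_holds`) by k6-g4's `mem_pSmul_of_red_eq_zero_of_lemma_8_5`.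
[cite: Kato2004Asterisque, §13.8 (pp. 228–229) with Lemma 8.5 (2) (p. 183)] -/
theorem mem_pSmul_of_red_eq_zero_holds : mem_pSmul_of_red_eq_zero :=
  mem_pSmul_of_red_eq_zero_of_lemma_8_5 mem_integralH1_of_forall_layerCores_eq_holds

end Literature.NumberTheory.EllipticCurves.Kato2004

end
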